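import Literature.Computability.AlgebraicComplexity.SymbolicMatrixDecomposition
import Literature.Computability.AlgebraicComplexity.RankMethodBarriers
import HarnessLib

/-!
# Coefficient spaces and the rank bound for linear images of polynomial matrices
(Efremenko–Garg–Oliveira–Wigderson 2018, §2.3 and the common core of Theorems 4.2 / 4.4)

Topic: `Literature/Computability/AlgebraicComplexity`. Third part of the proof of the rank-method
barriers (`RankMethodBarriers.lean`), after `SymbolicMatrixMinors.lean` and
`SymbolicMatrixDecomposition.lean`.

* `map_eval_eq_sum_coeff` — `K(b) = ∑_{s ∈ S} b^s • K_s` with the coefficient matrices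
  `K_s = coeff_s K` (Def. 2.9, the coefficient space `𝒞(K)` is spanned by the `K_s`).
* `rank_sum_smul_eval_mul_le_left` / `_right` — for polynomial matrices `K` (`ρ` columns, monomials
  in `S`) and `M` (`ρ` rows), every linear combination `∑_k c_k K(b_k) M(b_k)` has rank
  `≤ |S| · ρ` (Prop. 2.8 with Prop. 2.10 / 2.12: `dim 𝒞(f) ≤ #monomials`, and
  Cor. 2.11 / 2.13: `rk 𝒞(f ⊗ g) ≤ min`).
* `rank_sum_smul_eval_le_of_weighted` — **the engine of Theorems 4.2 and 4.4**: if the entries of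
  `P` are weighted-homogeneous of weight `ω`, all evaluations `P(b)` have rank `≤ r`, `T` is a
  complete finite set of splittings of `ω` and `S_ν ⊇ {monomials of weight ν}`, then every linear
  combination of evaluations of `P` has rank `≤ r · ∑_{(ω₁,ω₂) ∈ T} min(|S_{ω₁}|, |S_{ω₂}|)`
  ("`rk(L(f)) ≤ rk(𝒞(M(x))) ≤ R · n^{⌊d/2⌋}`", end of the proofs of Thm. 4.2 and Thm. 4.4).

## References

* [EfremenkoGargOliveiraWigderson2018] K. Efremenko, A. Garg, R. Oliveira, A. Wigderson,
  *Barriers for rank methods in arithmetic complexity*, ITCS 2018; arXiv:1710.09502, §2.2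
  (Prop. 2.8), §2.3 (Def. 2.9, Prop. 2.10, Cor. 2.11, Prop. 2.12, Cor. 2.13), §4.
-/

noncomputable section

open MvPolynomial

namespace Literature.Computability.AlgebraicComplexity

section CoefficientSpace

variable {F : Type*} [Field F] {σ : Type*} {ι : Type*} {ι' : Type*}

/-- **Coefficient expansion** (EGOW 2018, Def. 2.9): if every entry of the polynomial matrix `K`
has its monomials in `S`, then `K(b) = ∑_{s ∈ S} b^s • coeff_s K`. [cite: EfremenkoGargOliveiraWigderson2018, Def. 2.9] -/
theorem map_eval_eq_sum_coeff (K : Matrix ι ι' (MvPolynomial σ F)) (S : Finset (σ →₀ ℕ))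
    (hK : ∀ i k, (K i k).support ⊆ S) (b : σ → F) :
    K.map (eval b) = ∑ s ∈ S, eval b (monomial s 1) • K.map (coeff s) := by
  have key : ∀ p : MvPolynomial σ F, p.support ⊆ S →
      eval b p = ∑ s ∈ S, eval b (monomial s 1) * coeff s p := by
    intro p hp
    conv_lhs => rw [p.as_sum, map_sum]
    rw [Finset.sum_subset hp]
    · refine Finset.sum_congr rfl fun s _ => ?_
      rw [eval_monomial, eval_monomial, one_mul, mul_comm]
    · intro s _ hs
      rw [notMem_support_iff.mp hs, map_zero, map_zero]
  refine Matrix.ext fun i k => ?_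
  rw [Matrix.map_apply, key _ (hK i k), Matrix.sum_apply]
  simp [Matrix.smul_apply, Matrix.map_apply, smul_eq_mul]

variable [Fintype ι]

/-- **Rank through the left coefficient space** (EGOW 2018, Prop. 2.8 with Prop. 2.10 / 2.12):
if `K` has `ρ` columns and monomials in `S`, then `rank (∑_k c_k K(b_k) M(b_k)) ≤ |S| · ρ`, since
the column space lies in the span of the columns of the `|S|` coefficient matrices `K_s`.
[cite: EfremenkoGargOliveiraWigderson2018, Prop. 2.8 and Cor. 2.11] -/
theorem rank_sum_smul_eval_mul_le_left {ρ : ℕ} (K : Matrix ι (Fin ρ) (MvPolynomial σ F))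
    (M : Matrix (Fin ρ) ι (MvPolynomial σ F)) (S : Finset (σ →₀ ℕ))
    (hK : ∀ i k, (K i k).support ⊆ S) {κ : Type*} (pts : Finset κ) (b : κ → σ → F) (c : κ → F) :
    (∑ k ∈ pts, c k • (K.map (eval (b k)) * M.map (eval (b k)))).rank ≤ S.card * ρ := by
  have hexp : ∀ k ∈ pts, c k • (K.map (eval (b k)) * M.map (eval (b k))) =
      ∑ s ∈ S, K.map (coeff s) * ((c k * eval (b k) (monomial s 1)) • M.map (eval (b k))) := by
    intro k _
    rw [map_eval_eq_sum_coeff K S hK (b k), Matrix.sum_mul, Finset.smul_sum]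
    refine Finset.sum_congr rfl fun s _ => ?_
    rw [Matrix.smul_mul, smul_smul, Matrix.mul_smul]
  rw [Finset.sum_congr rfl hexp, Finset.sum_comm]
  simp_rw [← Matrix.mul_sum]
  refine (matrix_rank_sum_le _ _).trans ?_
  calc ∑ s ∈ S, (K.map (coeff s) *
          ∑ k ∈ pts, (c k * eval (b k) (monomial s 1)) • M.map (eval (b k))).rank
      ≤ ∑ _s ∈ S, ρ := Finset.sum_le_sum fun s _ =>
          (Matrix.rank_mul_le_left _ _).trans (by simpa using Matrix.rank_le_card_width (K.map (coeff s)))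
    _ = S.card * ρ := by simp

/-- **Rank through the right coefficient space**: if `M` has `ρ` rows and monomials in `S`, then
`rank (∑_k c_k K(b_k) M(b_k)) ≤ |S| · ρ`. [cite: EfremenkoGargOliveiraWigderson2018, Prop. 2.8 and Cor. 2.11] -/
theorem rank_sum_smul_eval_mul_le_right {ρ : ℕ} (K : Matrix ι (Fin ρ) (MvPolynomial σ F))
    (M : Matrix (Fin ρ) ι (MvPolynomial σ F)) (S : Finset (σ →₀ ℕ))
    (hM : ∀ k j, (M k j).support ⊆ S) {κ : Type*} (pts : Finset κ) (b : κ → σ → F) (c : κ → F) :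
    (∑ k ∈ pts, c k • (K.map (eval (b k)) * M.map (eval (b k)))).rank ≤ S.card * ρ := by
  have hexp : ∀ k ∈ pts, c k • (K.map (eval (b k)) * M.map (eval (b k))) =
      ∑ s ∈ S, ((c k * eval (b k) (monomial s 1)) • K.map (eval (b k))) * M.map (coeff s) := by
    intro k _
    rw [map_eval_eq_sum_coeff M S hM (b k), Matrix.mul_sum, Finset.smul_sum]
    refine Finset.sum_congr rfl fun s _ => ?_
    rw [Matrix.mul_smul, smul_smul, Matrix.smul_mul]
  rw [Finset.sum_congr rfl hexp, Finset.sum_comm]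
  simp_rw [← Matrix.sum_mul]
  refine (matrix_rank_sum_le _ _).trans ?_
  calc ∑ s ∈ S, ((∑ k ∈ pts, (c k * eval (b k) (monomial s 1)) • K.map (eval (b k))) *
          M.map (coeff s)).rank
      ≤ ∑ _s ∈ S, ρ := Finset.sum_le_sum fun s _ =>
          (Matrix.rank_mul_le_right _ _).trans (by simpa using Matrix.rank_le_card_height (M.map (coeff s)))
    _ = S.card * ρ := by simp

end CoefficientSpace

/-! ## The engine of Theorems 4.2 and 4.4 -/

section Engine

variable {F : Type*} [Field F] [Infinite F] {σ : Type*} [DecidableEq σ] {W : Type*} [AddCommMonoid W]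
  [DecidableEq W] {ι : Type*} [Fintype ι]

/-- **Rank barrier engine** (EGOW 2018, the common part of the proofs of Thm. 4.2 and Thm. 4.4):
let the entries of `P ∈ Mat_ι(F[x])` be weighted-homogeneous of weight `ω` (weight `w` with
`φ ∘ w = 1`), `F` infinite, `rank P(b) ≤ r` for every point `b`, `T` a finite set of splittings of `ω`
containing all splittings into monomial weights, and `S_ν` finite sets of monomials containing all
monomials of weight `ν`, for the weights `ν` occurring in `T`. Then every linear combination `∑_k c_k P(b_k)` — i.e. every element of the
coefficient space / of `L(Ŝ)` — has rank at most `r · ∑_{(ω₁, ω₂) ∈ T} min (|S_{ω₁}|, |S_{ω₂}|)`.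
[cite: EfremenkoGargOliveiraWigderson2018, Thm. 4.2 and Thm. 4.4] -/
theorem rank_sum_smul_eval_le_of_weighted (w : σ → W) (φ : W →+ ℕ) (hφ : ∀ v, φ (w v) = 1)
    (ω : W) (T : Finset (W × W)) (hT : ∀ x ∈ T, x.1 + x.2 = ω)
    (hT' : ∀ s t : σ →₀ ℕ, Finsupp.weight w s + Finsupp.weight w t = ω →
      (Finsupp.weight w s, Finsupp.weight w t) ∈ T)
    (S : W → Finset (σ →₀ ℕ)) (hS : ∀ x ∈ T, ∀ s : σ →₀ ℕ,
      (Finsupp.weight w s = x.1 → s ∈ S x.1) ∧ (Finsupp.weight w s = x.2 → s ∈ S x.2))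
    (P : Matrix ι ι (MvPolynomial σ F)) (hP : ∀ i j, IsWeightedHomogeneous w (P i j) ω)
    (r : ℕ) (hr : ∀ b : σ → F, (P.map (eval b)).rank ≤ r)
    {κ : Type*} (pts : Finset κ) (b : κ → σ → F) (c : κ → F) :
    (∑ k ∈ pts, c k • P.map (eval (b k))).rank ≤ r * ∑ x ∈ T, min (S x.1).card (S x.2).card := by
  obtain ⟨ρ, a, K, M, hρ, hK, hM, hPeq⟩ :=
    exists_weighted_decomposition w φ hφ ω T hT hT' P hP
  have hρr : ρ ≤ r := hρ.trans (hr a)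
  have hmap : ∀ β : σ → F, P.map (eval β) = ∑ x ∈ T, (K x.1).map (eval β) * (M x.2).map (eval β) := by
    intro β
    have h0 : ∀ A : Matrix ι ι (MvPolynomial σ F),
        A.map (eval β) = (eval β : MvPolynomial σ F →+ F).mapMatrix A := fun A => by
      rw [AddMonoidHom.mapMatrix_apply, AddMonoidHom.coe_coe]
    rw [h0, hPeq, map_sum]
    refine Finset.sum_congr rfl fun x _ => ?_
    rw [← h0, Matrix.map_mul]
  simp_rw [hmap, Finset.smul_sum]
  rw [Finset.sum_comm]
  refine (matrix_rank_sum_le _ _).trans ?_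
  rw [Finset.mul_sum]
  refine Finset.sum_le_sum fun x hx => ?_
  have h1 := rank_sum_smul_eval_mul_le_left (K x.1) (M x.2) (S x.1)
    (fun i k s hs => (hS x hx s).1 (hK x.1 i k (mem_support_iff.mp hs))) pts b c
  have h2 := rank_sum_smul_eval_mul_le_right (K x.1) (M x.2) (S x.2)
    (fun k j s hs => (hS x hx s).2 (hM x.2 k j (mem_support_iff.mp hs))) pts b c
  calc (∑ k ∈ pts, c k • ((K x.1).map (eval (b k)) * (M x.2).map (eval (b k)))).rank
      ≤ min (S x.1).card (S x.2).card * ρ := by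
        rcases min_choice (S x.1).card (S x.2).card with h | h <;> rw [h] <;> assumption
    _ ≤ r * min (S x.1).card (S x.2).card := by
        rw [mul_comm]; exact Nat.mul_le_mul_right _ hρr

end Engine

end Literature.Computability.AlgebraicComplexity
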